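import Literature.MathematicalPhysics.QuantumManyBody.PeriodicBoseGas
import HarnessLib

/-!
# LSSY Theorem 2.2 (the Dyson–Lieb–Seiringer–Yngvason upper bound): proof architecture

Topic `Literature/MathematicalPhysics/QuantumManyBody`, sibling of `PeriodicBoseGas.lean`
(provefact `Literature.MathematicalPhysics.QuantumManyBody.BoseGas.LSSY2005_upperBound_periodic`). The printed proof of
[LSSY2005, Thm. 2.2 (2.14)], pp. 12–13 of arXiv:cond-mat/0610117, has three ingredients:

1. a two-body **profile** `f(|x|)` with `0 ≤ f ≤ 1`, `f = 1` beyond a cut-off `b` (2.17)–(2.18), built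
   from the zero-energy scattering solution of App. C, whose three integrals obey
   `E₁ = ∫ (2μf'² + v f²) ≤ 8πμa/(1 - a/b)` (2.27)–(2.28) (from Thm. C.1 (C.8):
   `min E_b = 4πμa/(1-a/b)`), `I = ∫ (1 - f²) = O(ab²)` (after (2.29)) and
   `K = ∫ f f' = O(ab)` (after (2.31)), both via `f ≥ [1-a/r]₊` (Lemma C.2 (A));
2. an `N`-body **product trial state** built from the profile, whose energy is bounded by eliminating
   one particle at a time (2.19)–(2.26), giving
   `E₀(N,L) ≤ [pair terms] E₁/(L³ - (N-1)I)-type + [three-body terms] K²/(L³-(N-1)I)²-type`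
   (2.30)–(2.31);
3. the **optimisation** `b = (4πρ₁/3)^{-1/3}`, `(N-1)I/L³ = O(a/b)`, `NK²/(N E₁ L³)… = O(a/b)`
   (2.32)–(2.33), yielding `E₀/N ≤ 4πμρ₁a(1 + O(a/b))`.

This file fixes the interface between the three steps for the objects of `PeriodicBoseGas.lean`
(units `μ = 1`, `a := (scatteringLength v).toReal`), states steps 1 and 2 as named facts, and
*proves* step 3, i.e. the implication
`LSSY2005_dysonProfile → LSSY2005_zeroScatteringLength → LSSY2005_jastrowBound →
LSSY2005_upperBound_periodic` (`LSSY2005_upperBound_periodic_of_layers`). The named facts are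
proved in the sibling files `PeriodicBoseGasScattering.lean` (`LSSY2005_dysonProfile_holds`,
`LSSY2005_zeroScatteringLength_holds`: polar coordinates, the capacity of the annulus along rays,
and an explicit `C¹` gluing of a clamped near-minimising ray to the harmonic tail) and
`PeriodicBoseGasJastrow.lean` (`LSSY2005_jastrowBound_holds`: the product state over all pairs),
and `PeriodicBoseGasUpperBoundProofs.lean` concludes `LSSY2005_upperBound_periodic_holds`.

* `IsPairProfile b φ`: `φ : ℝ³ → ℝ` of class `C¹`, even, `0 ≤ φ ≤ 1`, `φ = 1` off the ball `B_b`
  (the regularity is that of `PeriodicTrialState`; the source's `f₀/f₀(b)` is only piecewise `C¹`,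
  which is why step 1 is stated up to `ε`). `profileEnergy v φ = 2𝓔[φ] = E₁`,
  `profileDefect φ = I`, `profileK φ = ∫ φ|∇φ| = K` (`= ∫ f f'` for a monotone radial profile).
* **Step 1** (`LSSY2005_dysonProfile`, App. C Thm. C.1 (C.8) with (2.27)–(2.32)): for `a > 0` there
  is `b₀` (depending on `v`) such that for all `b ≥ b₀` and `ε > 0` some pair profile with cut-off
  `b` has `E₁ ≤ 8πa/(1-a/b) + ε`, `I ≤ 16πab²`, `K ≤ 16πab`. The source's constants are
  `I ≤ (4π/3)ab²·O(1)`, `K ≤ 4πab(1 + O(a/b))`; ours are weaker numerics (they only move the unprinted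
  `const` of (2.14)) chosen so that the statement follows from (C.8) and the explicit tail
  `1 - a_b(1/r - 1/b)` of the minimiser alone, the core `r ≤ R₀` being bounded by its volume — hence
  the threshold `b₀(v)`. Companion `LSSY2005_zeroScatteringLength`: `a = 0` forces `v(|x|) = 0`
  a.e. (then `φ ≡ 1` is a profile with `E₁ = I = K = 0`); by (C.8) the minimal energy vanishes with
  `a`, so the minimiser is constant and `∫ v = 0`.
* **Step 2** (`LSSY2005_jastrowBound`): for a pair profile with `2b < L` and bounds `E, I, K` on
  `E₁, I, K` with `(N-1)I < L³`,
  `E₀(N,L) ≤ N(N-1)/2 · E/(L³-(N-1)I) + N(N-1)(N-2) K²/(L³-(N-1)I)²`.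
  This is the bound (2.30)–(2.31) of the source for the *symmetric* product (Jastrow) state
  `Ψ = ∏_{i<j} f(|xᵢ - xⱼ|_{torus})` instead of Dyson's nearest-neighbour state (2.15)–(2.16): the
  one-particle elimination (2.22)–(2.26) applies verbatim (`F ≤ 1`, `∏(1 - gⱼ) ≥ 1 - ∑ gⱼ`), the pair
  terms give `E₁/(L³-(N-1)I)` (the source has the slightly larger `E₁L³/(L³-(N-1)I)²`) and the
  three-body terms `F'ₖᵢF'ₖⱼ` give `K²/(L³-(N-1)I)²` with combinatorial factor `N(N-1)(N-2)` (the
  source's ordering `k < i < j` gives `2/3` of it). The symmetric state is admissible directly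
  (`PeriodicTrialState` is Bose-symmetric and `C¹`), which avoids the first paragraph of the printed
  proof (bosonic = absolute ground state) and the Lipschitz nearest-neighbour distances. It holds for
  every measurable `v ≥ 0` (no range condition: `v^per F² ≤ ∑ₙ (v f²)(· - Ln)` termwise).
* **Step 3** (proved): with `b = (4πρ₁/3)^{-1/3}` and the profile cut off at `β = b/4` (so that
  `2β < L` also for `N = 2`, where `b ≈ 0.62 L`), `x = a/b ≤ 1/16`: `(N-1)·16πaβ² = (3/4)xL³` and the
  bound of step 2 is `4πρ₁aN · [1/((1-4x)(1-3x/4)) + (N-2)/(N-1) · 3x/(1-3x/4)²] ≤ 4πρ₁aN(1 + 12x)`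
  (`jastrow_optimisation`), after `ε → 0`; for `a = 0` the bound is `0`. Constants: `C = 12`,
  `c = min(1/16, a/(4b₀))`.

## References

* [LSSY2005] E. H. Lieb, R. Seiringer, J. P. Solovej, J. Yngvason, *The Mathematics of the Bose
  Gas and its Condensation*, Oberwolfach Seminars 34, Birkhäuser 2005, arXiv:cond-mat/0610117:
  Thm. 2.2 (2.14) and its proof (2.15)–(2.33), pp. 12–13; App. C, Thm. C.1 (C.4)–(C.8),
  Lemma C.2.
* [Dyson1957] F. J. Dyson, *Ground-state energy of a hard-sphere gas*, Phys. Rev. 106 (1957),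
  20–26 (the trial function (2.15) and the elimination bounds).
* [LiebSeiringerYngvason2000] E. H. Lieb, R. Seiringer, J. Yngvason, *Bosons in a trap: A rigorous
  derivation of the Gross–Pitaevskii energy functional*, Phys. Rev. A 61 (2000), 043602 (the
  generalisation of Dyson's bound to general `v ≥ 0`, cited as [LSY1999] in the source).
-/

noncomputable section

open MeasureTheory Filter Topology Set WithLp
open scoped ENNReal NNReal

namespace Literature.MathematicalPhysics.QuantumManyBody.BoseGas

/-! ### Pair profiles and their three integrals -/

/-- The gradient vector `∇φ(x) = (∂₁φ(x), ∂₂φ(x), ∂₃φ(x)) ∈ ℝ³` of a real function on `ℝ³` (partial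
derivatives along the coordinate axes, `0` where `φ` is not differentiable); `gradSq φ x = |∇φ(x)|²`.
[cite: LSSY2005, App. C (C.4)] -/
def gradVec (φ : Space → ℝ) (x : Space) : Space :=
  toLp 2 fun k => fderiv ℝ φ x (EuclideanSpace.single k (1 : ℝ))

/-- **Two-body (pair) profiles** with cut-off radius `b`: `φ : ℝ³ → ℝ` of class `C¹`, even,
`0 ≤ φ ≤ 1`, and `φ(x) = 1` for `|x| ≥ b` [(2.17): `0 ≤ f ≤ 1`; (2.18): `f(|x|) = 1` for `|x| ≥ b`;
evenness is automatic for the radial `f(|x|)` of the source and is what makes the product state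
`∏_{i<j} φ(xᵢ - xⱼ)` Bose-symmetric]. Monotonicity `f' ≥ 0` (2.17) is not recorded: it only serves
to write `∫ f|f'|` as `∫ f f'`. [cite: LSSY2005, Thm. 2.2, proof, (2.17)–(2.18)] -/
structure IsPairProfile (b : ℝ) (φ : Space → ℝ) : Prop where
  contDiff : ContDiff ℝ 1 φ
  nonneg : ∀ x, 0 ≤ φ x
  le_one : ∀ x, φ x ≤ 1
  even : ∀ x, φ (-x) = φ x
  eq_one : ∀ x, b ≤ ‖x‖ → φ x = 1

/-- `E₁ = ∫_{ℝ³} (2μ|∇φ|² + v(|x|) φ²) dx = 2𝓔[φ] ∈ [0, ∞]` (`μ = 1`), twice the scattering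
functional. [cite: LSSY2005, Thm. 2.2, proof, (2.27)–(2.28)] -/
def profileEnergy (v : ℝ → ℝ≥0∞) (φ : Space → ℝ) : ℝ≥0∞ :=
  2 * scatteringFunctional v φ

/-- `I = ∫_{ℝ³} (1 - φ²) dx ∈ [0, ∞]`, the volume defect of a profile.
[cite: LSSY2005, Thm. 2.2, proof, (2.29)] -/
def profileDefect (φ : Space → ℝ) : ℝ≥0∞ :=
  ∫⁻ x, ENNReal.ofReal (1 - φ x ^ 2)

/-- `K = ∫_{ℝ³} φ |∇φ| dx ∈ [0, ∞]` (`= ∫ f(|x|) f'(|x|) dx` for a monotone radial profile).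
[cite: LSSY2005, Thm. 2.2, proof, (2.31)–(2.32)] -/
def profileK (φ : Space → ℝ) : ℝ≥0∞ :=
  ∫⁻ x, ENNReal.ofReal (φ x * ‖gradVec φ x‖)

/-! ### The two analytic layers, as named facts -/

/-- **LSSY 2005, App. C Thm. C.1 (C.8) as a trial profile** (step 1 of the proof of Thm. 2.2).
Let `v ≥ 0` be measurable of finite range `R₀` with scattering length `0 < a < ∞`. By Thm. C.1, for
`b > R₀` the functional `E_b[φ] = ∫_{B_b} (μ|∇φ|² + ½v|φ|²)` restricted to `φ = 1` on `S_b` has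
minimum `4πμa/(1 - a/b)` (C.8), attained at `φ₀ = f₀(|x|)/f₀(b)` with `f₀(r) = c(1 - a/r)` for
`R₀ < r ≤ b` (C.7); so the profile `f = f₀/f₀(b)` on `[0,b]`, `f = 1` beyond (2.18), has
`E₁ = ∫(2μf'² + vf²) = 8πμa/(1-a/b)` (2.27)–(2.28), and its tail `1 - a_b(1/r - 1/b)`,
`a_b = a/(1-a/b)`, contributes at most `4πa_b b²` to `I = ∫(1-f²)` and `4πa_b b` to `K = ∫ff'`,
the core `r ≤ R₀` at most its volume resp. `(E₁|B_{R₀}|/2)^{1/2}` (the source bounds the core too,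
by `f ≥ [1-a/r]₊`, Lemma C.2 (A), getting `I ≤ (4π/3)ab²·O(1)`, `K ≤ 4πab(1+O(a/b))`). Vendored
form (units `μ = 1`, `a := (scatteringLength v).toReal`, `C¹` even profiles, hence up to `ε` in the
energy since the exact `f` is only piecewise `C¹`): there is `b₀ > a` such that for all `b ≥ b₀` and
`ε > 0` some pair profile with cut-off `b` has `E₁ ≤ 8πa/(1-a/b) + ε`, `I ≤ 16πab²`, `K ≤ 16πab`.
[cite: LSSY2005, App. C, Thm. C.1 (C.4)–(C.8); Thm. 2.2, proof, (2.17)–(2.18), (2.27)–(2.32)] -/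
def LSSY2005_dysonProfile : Prop :=
  ∀ (v : ℝ → ℝ≥0∞) (R₀ : ℝ), Measurable v → (∀ r, R₀ < r → v r = 0) →
    scatteringLength v ≠ ⊤ → 0 < scatteringLength v →
    ∃ b₀ : ℝ, (scatteringLength v).toReal < b₀ ∧
      ∀ (b ε : ℝ), b₀ ≤ b → 0 < ε →
        let a := (scatteringLength v).toReal
        ∃ φ : Space → ℝ, IsPairProfile b φ ∧
          profileEnergy v φ ≤ ENNReal.ofReal (8 * Real.pi * a / (1 - a / b) + ε) ∧
          profileDefect φ ≤ ENNReal.ofReal (16 * Real.pi * a * b ^ 2) ∧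
          profileK φ ≤ ENNReal.ofReal (16 * Real.pi * a * b)

/-- **LSSY 2005, App. C: zero scattering length means no interaction.** For measurable `v ≥ 0` of
finite range, `a = 0` forces `v(|x|) = 0` for a.e. `x ∈ ℝ³`: by Thm. C.1 (C.8) the minimum of
`E_R` is `4πμa/(1-a/R) = 0`, so the (unique, non-negative, radial) minimiser has `∇φ₀ = 0`,
`φ₀ ≡ 1`, and `∫ v φ₀² = ∫ v = 0`. (Conversely `v = 0` a.e. gives `a = 0` by the trial function
`φ ≡ 1`, `four_pi_mul_scatteringLength_le`.) Then `φ ≡ 1` is a pair profile with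
`E₁ = I = K = 0`, the case `a = 0` of step 1. [cite: LSSY2005, App. C, Thm. C.1 (C.8)] -/
def LSSY2005_zeroScatteringLength : Prop :=
  ∀ (v : ℝ → ℝ≥0∞) (R₀ : ℝ), Measurable v → (∀ r, R₀ < r → v r = 0) →
    scatteringLength v = 0 → ∀ᵐ x : Space, v ‖x‖ = 0

/-- **LSSY 2005, proof of Thm. 2.2, step 2: the product trial state** [(2.19)–(2.26), (2.30)–(2.31)],
in the symmetric (Jastrow) variant. Let `v ≥ 0` be measurable, `N ≥ 2`, `L > 0`, and let `φ` be a
pair profile with cut-off `b`, `0 < 2b < L`, so that `Φ(y) = φ(y - Ln)` for the nearest lattice point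
`Ln` is `C¹` and `Lℤ³`-periodic. If `E₁ = 2𝓔[φ] ≤ E`, `I = ∫(1-φ²) ≤ I'`, `K = ∫ φ|∇φ| ≤ K'` and
`(N-1)I' < L³`, then `Ψ = ∏_{i<j} Φ(xᵢ - xⱼ)` is an admissible periodic trial state after
normalisation and
`⟨Ψ,HΨ⟩/⟨Ψ,Ψ⟩ ≤ N(N-1)/2 · E/(L³-(N-1)I') + N(N-1)(N-2) K'²/(L³-(N-1)I')²`:
as in the source, `|∇ₖΨ|² ≤ ∑_{i≠k} |∇Φ|²(x_k-x_i)·Ψₖ² + ∑_{i≠j≠k} (Φ|∇Φ|)(x_k-x_i)(Φ|∇Φ|)(x_k-x_j)·Ψᵢⱼ²`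
with all other factors bounded by `1` [(2.19)–(2.21)], `v^per(xᵢ-xⱼ)Ψ² ≤ (vφ²)^per(xᵢ-xⱼ)Ψᵢ²`,
`∫Ψ² ≥ (L³ - (N-1)I')∫Ψᵢ²/L³` from `∏(1-gⱼ) ≥ 1 - ∑gⱼ` [(2.22)–(2.26)], and
`∫_Ω e^per(x - y) dx = ∫_{ℝ³} e` for the periodisations [(2.27), (2.29), (2.31)]. (Dyson's
nearest-neighbour state (2.15)–(2.16) gives the same with `E L³/(L³-(N-1)I')²` and the factor `2/3`
in front of the second term; the symmetric product avoids the first paragraph of the printed proof.)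
[cite: LSSY2005, Thm. 2.2, proof, (2.19)–(2.31); Dyson1957] -/
def LSSY2005_jastrowBound : Prop :=
  ∀ (v : ℝ → ℝ≥0∞), Measurable v →
  ∀ (N : ℕ) (L b : ℝ), 2 ≤ N → 0 < L → 0 < b → 2 * b < L →
  ∀ (φ : Space → ℝ), IsPairProfile b φ →
  ∀ (E I K : ℝ), 0 ≤ E → 0 ≤ I → 0 ≤ K →
    profileEnergy v φ ≤ ENNReal.ofReal E → profileDefect φ ≤ ENNReal.ofReal I →
    profileK φ ≤ ENNReal.ofReal K → ((N : ℝ) - 1) * I < L ^ 3 →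
    periodicGroundStateEnergy v N L ≤ ENNReal.ofReal
      (N * ((N : ℝ) - 1) / 2 * E / (L ^ 3 - ((N : ℝ) - 1) * I) +
        N * ((N : ℝ) - 1) * ((N : ℝ) - 2) * K ^ 2 / (L ^ 3 - ((N : ℝ) - 1) * I) ^ 2)

/-! ### The trivial profile `φ ≡ 1` (the case `a = 0`) -/

section TrivialProfile

/-- `∇1 = 0`. [folklore] -/
@[simp]
theorem gradVec_const (c : ℝ) (x : Space) : gradVec (fun _ => c) x = 0 := by
  ext k
  simp [gradVec]

/-- `|∇1|² = 0`. [folklore] -/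
@[simp]
theorem gradSq_const (c : ℝ) (x : Space) : gradSq (fun _ => c) x = 0 := by
  simp [gradSq]

/-- The constant `1` is a pair profile for every cut-off. [folklore] -/
theorem isPairProfile_one (b : ℝ) : IsPairProfile b fun _ => (1 : ℝ) where
  contDiff := contDiff_const
  nonneg _ := zero_le_one
  le_one _ := le_rfl
  even _ := rfl
  eq_one _ _ := rfl

/-- `I(1) = 0`. [folklore] -/
@[simp]
theorem profileDefect_one : profileDefect (fun _ => (1 : ℝ)) = 0 := by
  simp [profileDefect]

/-- `K(1) = 0`. [folklore] -/
@[simp]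
theorem profileK_one : profileK (fun _ => (1 : ℝ)) = 0 := by
  simp [profileK]

/-- `E₁(1) = ∫ v(|x|) dx`, which vanishes when `v(|x|) = 0` a.e. [folklore] -/
theorem profileEnergy_one_eq_zero {v : ℝ → ℝ≥0∞} (hv : ∀ᵐ x : Space, v ‖x‖ = 0) :
    profileEnergy v (fun _ => (1 : ℝ)) = 0 := by
  have h : scatteringFunctional v (fun _ => (1 : ℝ)) = 0 := by
    unfold scatteringFunctional
    have hae : (fun x : Space =>
        gradSq (fun _ => (1 : ℝ)) x + 2⁻¹ * v ‖x‖ * (‖(1 : ℝ)‖₊ : ℝ≥0∞) ^ 2) =ᵐ[volume]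
        fun _ => 0 := by
      filter_upwards [hv] with x hx
      simp [hx]
    rw [lintegral_congr_ae hae, lintegral_zero]
  simp [profileEnergy, h]

end TrivialProfile

/-! ### Assembly: Theorem 2.2 from the layers -/

/-- Steps 1 and 2 combined at cut-off radius `β` and slack `ε → 0`, for `a > 0`:
`E₀(N,L) ≤ N(N-1)/2 · (8πa/(1-a/β))/(L³ - (N-1)16πaβ²) + N(N-1)(N-2)(16πaβ)²/(L³-(N-1)16πaβ²)²`
whenever `β ≥ b₀(v)`, `2β < L` and `(N-1)16πaβ² < L³`.
[cite: LSSY2005, Thm. 2.2, proof, (2.28)–(2.32)] -/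
theorem periodicGroundStateEnergy_le_jastrow (hB : LSSY2005_jastrowBound) {v : ℝ → ℝ≥0∞}
    (hv : Measurable v) {b₀ : ℝ} (hab₀ : (scatteringLength v).toReal < b₀)
    (hA : ∀ (b ε : ℝ), b₀ ≤ b → 0 < ε →
      ∃ φ : Space → ℝ, IsPairProfile b φ ∧
        profileEnergy v φ ≤ ENNReal.ofReal
          (8 * Real.pi * (scatteringLength v).toReal / (1 - (scatteringLength v).toReal / b) + ε) ∧
        profileDefect φ ≤ ENNReal.ofReal (16 * Real.pi * (scatteringLength v).toReal * b ^ 2) ∧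
        profileK φ ≤ ENNReal.ofReal (16 * Real.pi * (scatteringLength v).toReal * b))
    {N : ℕ} {L β : ℝ} (hN : 2 ≤ N) (hL : 0 < L) (hβ₀ : b₀ ≤ β) (hβL : 2 * β < L)
    (hI : ((N : ℝ) - 1) * (16 * Real.pi * (scatteringLength v).toReal * β ^ 2) < L ^ 3) :
    periodicGroundStateEnergy v N L ≤ ENNReal.ofReal
      (N * ((N : ℝ) - 1) / 2 *
          (8 * Real.pi * (scatteringLength v).toReal / (1 - (scatteringLength v).toReal / β)) /
          (L ^ 3 - ((N : ℝ) - 1) * (16 * Real.pi * (scatteringLength v).toReal * β ^ 2)) +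
        N * ((N : ℝ) - 1) * ((N : ℝ) - 2) *
          (16 * Real.pi * (scatteringLength v).toReal * β) ^ 2 /
          (L ^ 3 - ((N : ℝ) - 1) * (16 * Real.pi * (scatteringLength v).toReal * β ^ 2)) ^ 2) := by
  set a := (scatteringLength v).toReal with ha_def
  set n₁ : ℝ := (N : ℝ) - 1 with hn₁
  set E₀ : ℝ := 8 * Real.pi * a / (1 - a / β)
  set I₀ : ℝ := 16 * Real.pi * a * β ^ 2
  set K₀ : ℝ := 16 * Real.pi * a * β
  -- the bound as a function of the slack `ε`
  set G : ℝ → ℝ := fun ε =>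
    N * n₁ / 2 * (E₀ + ε) / (L ^ 3 - n₁ * I₀) +
      N * n₁ * ((N : ℝ) - 2) * K₀ ^ 2 / (L ^ 3 - n₁ * I₀) ^ 2 with hG
  have ha0 : 0 ≤ a := ENNReal.toReal_nonneg
  have hβ : 0 < β := by linarith
  have haβ : a < β := by linarith
  have haβ1 : a / β < 1 := (div_lt_one hβ).mpr haβ
  have hE₀ : 0 ≤ E₀ := div_nonneg (by positivity) (by linarith)
  have hI₀ : 0 ≤ I₀ := by positivity
  have hK₀ : 0 ≤ K₀ := by positivity
  -- for every `ε > 0`, steps 1 and 2 give `E₀(N,L) ≤ G ε`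
  have hev : ∀ᶠ ε in 𝓝[>] (0 : ℝ), periodicGroundStateEnergy v N L ≤ ENNReal.ofReal (G ε) := by
    filter_upwards [eventually_mem_nhdsWithin] with ε hε
    rw [Set.mem_Ioi] at hε
    obtain ⟨φ, hφ, hφE, hφI, hφK⟩ := hA β ε hβ₀ hε
    simpa only [hG] using hB v hv N L β hN hL hβ hβL φ hφ (E₀ + ε) I₀ K₀
      (by positivity) hI₀ hK₀ hφE hφI hφK hI
  -- `G` is continuous at `0`
  have hlim : Tendsto G (𝓝[>] 0) (𝓝 (G 0)) := by
    refine Tendsto.mono_left ?_ nhdsWithin_le_nhds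
    simp only [hG]
    exact Continuous.tendsto (by fun_prop) 0
  simpa [hG] using ge_of_tendsto (ENNReal.tendsto_ofReal hlim) hev

/-- The scalar inequality behind "`(1 + O(a/b))`" in (2.32)–(2.33), for the profile cut off at
`b/4` (`x = a/b`): `1/((1-4x)(1-3x/4)) + t · 3x/(1-3x/4)² ≤ 1 + 12x` for `0 ≤ x ≤ 1/16`,
`t ≤ 1`. [cite: LSSY2005, Thm. 2.2, proof, (2.32)–(2.33)] -/
theorem jastrow_scalar_bound {x t : ℝ} (hx0 : 0 ≤ x) (hx : x ≤ 1 / 16) (ht : t ≤ 1) :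
    1 / ((1 - 4 * x) * (1 - 3 * x / 4)) + t * (3 * x / (1 - 3 * x / 4) ^ 2) ≤ 1 + 12 * x := by
  have h1 : 0 < 1 - 4 * x := by linarith
  have h2 : 0 < 1 - 3 * x / 4 := by linarith
  have h3 : t * (3 * x / (1 - 3 * x / 4) ^ 2) ≤ 3 * x / (1 - 3 * x / 4) ^ 2 :=
    mul_le_of_le_one_left (by positivity) ht
  have h4 : 1 / ((1 - 4 * x) * (1 - 3 * x / 4)) + 3 * x / (1 - 3 * x / 4) ^ 2 ≤ 1 + 12 * x := by
    rw [div_add_div _ _ (by positivity) (by positivity), div_le_iff₀ (by positivity)]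
    have h5 : 0 ≤ x * (1 / 16 - x) := mul_nonneg hx0 (by linarith)
    nlinarith [h5, mul_nonneg h5 hx0, mul_nonneg (mul_nonneg h5 hx0) hx0, pow_nonneg hx0 2,
      mul_nonneg (pow_nonneg hx0 2) hx0, mul_nonneg (mul_nonneg (pow_nonneg hx0 2) hx0) hx0]
  linarith

/-- The optimisation step (2.32)–(2.33) of the proof of Thm. 2.2, for the profile cut off at `b/4`
with `(4π/3) ρ₁ b³ = 1`, `ρ₁ = (N-1)/L³`, `x = a/b ≤ 1/16`: the bound of step 2 with
`E = 8πa/(1-4x)`, `I = 16πa(b/4)² = πab²` (so `(N-1)I = (3/4)xL³`), `K = 16πa(b/4) = 4πab` equals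
`4πρ₁aN · [1/((1-4x)(1-3x/4)) + (N-2)/(N-1) · 3x/(1-3x/4)²] ≤ 4πρ₁a(1 + 12x)N`.
[cite: LSSY2005, Thm. 2.2, proof, (2.30)–(2.33)] -/
theorem jastrow_optimisation {N L a b : ℝ} (hN : 2 ≤ N) (ha : 0 < a) (hb : 0 < b)
    (hx : a / b ≤ 1 / 16) (hb3 : 4 * Real.pi * (N - 1) * b ^ 3 = 3 * L ^ 3) :
    N * (N - 1) / 2 * (8 * Real.pi * a / (1 - a / (b / 4))) /
          (L ^ 3 - (N - 1) * (16 * Real.pi * a * (b / 4) ^ 2)) +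
        N * (N - 1) * (N - 2) * (16 * Real.pi * a * (b / 4)) ^ 2 /
          (L ^ 3 - (N - 1) * (16 * Real.pi * a * (b / 4) ^ 2)) ^ 2 ≤
      4 * Real.pi * ((N - 1) / L ^ 3) * a * (1 + 12 * (a / b)) * N := by
  obtain ⟨x, hx0, rfl⟩ : ∃ x, 0 < x ∧ a = x * b := ⟨a / b, by positivity, by field_simp⟩
  have hxb : x * b / b = x := by field_simp
  rw [hxb] at hx ⊢
  obtain ⟨n, hn, rfl⟩ : ∃ n, 1 ≤ n ∧ N = n + 1 := ⟨N - 1, by linarith, by ring⟩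
  simp only [add_sub_cancel_right] at hb3 ⊢
  have hL3 : L ^ 3 = 4 * Real.pi * n * b ^ 3 / 3 := by linarith
  rw [hL3]
  have hπ := Real.pi_pos
  have h1 : 0 < 1 - 4 * x := by linarith
  have h2 : 0 < 1 - 3 * x / 4 := by linarith
  have hn0 : 0 < n := by linarith
  have h1' : 1 - 4 * x ≠ 0 := h1.ne'
  have h1'' : 1 - x * 4 ≠ 0 := by linarith
  have h2' : 4 - x * 3 ≠ 0 := by nlinarith
  have h2'' : 4 / 3 - x ≠ 0 := by nlinarith
  have h2d : 4 - 3 * x ≠ 0 := by nlinarith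
  have hb' : b ≠ 0 := hb.ne'
  have hn' : n ≠ 0 := hn0.ne'
  have hπ' : Real.pi ≠ 0 := hπ.ne'
  -- normalise both sides
  have hD : 4 * Real.pi * n * b ^ 3 / 3 - n * (16 * Real.pi * (x * b) * (b / 4) ^ 2) =
      Real.pi * n * b ^ 3 * (4 / 3 - x) := by ring
  have h14 : 1 - x * b / (b / 4) = 1 - 4 * x := by field_simp
  rw [hD, h14]
  have hT1 : (n + 1) * n / 2 * (8 * Real.pi * (x * b) / (1 - 4 * x)) /
        (Real.pi * n * b ^ 3 * (4 / 3 - x)) =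
      3 * (n + 1) * x / b ^ 2 * (1 / ((1 - 4 * x) * (1 - 3 * x / 4))) := by
    field_simp
    ring
  have hT2 : (n + 1) * n * (n + 1 - 2) * (16 * Real.pi * (x * b) * (b / 4)) ^ 2 /
        (Real.pi * n * b ^ 3 * (4 / 3 - x)) ^ 2 =
      3 * (n + 1) * x / b ^ 2 * ((n - 1) / n * (3 * x / (1 - 3 * x / 4) ^ 2)) := by
    field_simp
    ring
  have hrhs : 4 * Real.pi * (n / (4 * Real.pi * n * b ^ 3 / 3)) * (x * b) * (1 + 12 * x) * (n + 1) =
      3 * (n + 1) * x / b ^ 2 * (1 + 12 * x) := by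
    field_simp
  rw [hT1, hT2, ← mul_add, hrhs]
  refine mul_le_mul_of_nonneg_left ?_ (by positivity)
  refine jastrow_scalar_bound hx0.le hx ?_
  rw [div_le_one hn0]
  linarith

/-- **LSSY Theorem 2.2 from its layers.** The Dyson–LSSY upper bound
`LSSY2005_upperBound_periodic` (`E₀(N,L)/N ≤ 4πρ₁a(1 + C a/b)` for `a/b ≤ c`) follows from the
profile of App. C (step 1, with its `a = 0` companion) and the product-state bound (step 2), with
`C = 12` and `c = min(1/16, a/(4b₀))` (the second entry makes the cut-off `b/4` exceed the
threshold `b₀(v)` of step 1); for `a = 0` both sides vanish (`φ ≡ 1`).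
[cite: LSSY2005, Thm. 2.2 (2.14), proof pp. 12–13] -/
theorem LSSY2005_upperBound_periodic_of_layers (hA : LSSY2005_dysonProfile)
    (hA₀ : LSSY2005_zeroScatteringLength) (hB : LSSY2005_jastrowBound) :
    LSSY2005_upperBound_periodic := by
  intro v R₀ hv hR ha
  rcases eq_or_ne (scatteringLength v) 0 with ha0 | ha0
  · -- the free case `a = 0`: `v = 0` a.e., the profile `φ ≡ 1` has `E₁ = I = K = 0`
    have hv0 : ∀ᵐ x : Space, v ‖x‖ = 0 := hA₀ v R₀ hv hR ha0
    refine ⟨1, 1, one_pos, one_pos, fun N L hN hL _ => ?_⟩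
    dsimp only
    intro _
    have hβ : 0 < L / 4 := by positivity
    have hβL : 2 * (L / 4) < L := by linarith
    have h := hB v hv N L (L / 4) hN hL hβ hβL (fun _ => 1) (isPairProfile_one _) 0 0 0 le_rfl
      le_rfl le_rfl (by rw [profileEnergy_one_eq_zero hv0]; exact bot_le) (by simp) (by simp)
      (by simp only [mul_zero]; positivity)
    have h0 : periodicGroundStateEnergy v N L = 0 := by simpa using h
    simp [ha0, h0]
  · -- `a > 0`
    have ha0 : 0 < scatteringLength v := pos_iff_ne_zero.mpr ha0
    set a := (scatteringLength v).toReal with ha_def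
    have ha0' : 0 < a := ENNReal.toReal_pos ha0.ne' ha
    obtain ⟨b₀, hab₀, hA'⟩ := hA v R₀ hv hR ha ha0
    have hb₀ : 0 < b₀ := ha0'.trans hab₀
    refine ⟨12, min (1 / 16) (a / (4 * b₀)), by norm_num, lt_min (by norm_num) (by positivity),
      fun N L hN hL _ => ?_⟩
    dsimp only
    intro hab
    set b : ℝ := (4 * Real.pi * (((N : ℝ) - 1) / L ^ 3) / 3) ^ (-(1 : ℝ) / 3) with hb_def
    have hN' : (2 : ℝ) ≤ N := by exact_mod_cast hN
    have hn₁ : (1 : ℝ) ≤ (N : ℝ) - 1 := by linarith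
    have ht : 0 < 4 * Real.pi * (((N : ℝ) - 1) / L ^ 3) / 3 := by positivity
    have hb0 : 0 < b := Real.rpow_pos_of_pos ht _
    have hb3 : 4 * Real.pi * ((N : ℝ) - 1) * b ^ 3 = 3 * L ^ 3 := by
      have h3 : b ^ 3 = (4 * Real.pi * (((N : ℝ) - 1) / L ^ 3) / 3)⁻¹ := by
        rw [hb_def, ← Real.rpow_natCast, ← Real.rpow_mul ht.le]
        norm_num
        rw [Real.rpow_neg_one, inv_div]
      rw [h3]
      field_simp
    have hx : a / b ≤ 1 / 16 := hab.trans (min_le_left _ _)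
    have hb4 : b₀ ≤ b / 4 := by
      have h := hab.trans (min_le_right _ _)
      rw [div_le_div_iff_of_pos_left ha0' hb0 (by positivity)] at h
      linarith
    have hbL : b < L := by
      refine lt_of_pow_lt_pow_left₀ 3 hL.le ?_
      have hL3 : 0 < L ^ 3 := by positivity
      have hb3' : 0 < b ^ 3 := by positivity
      have h1 : b ^ 3 ≤ ((N : ℝ) - 1) * b ^ 3 := le_mul_of_one_le_left hb3'.le hn₁
      have h2 : 4 * Real.pi * b ^ 3 ≤ 4 * Real.pi * (((N : ℝ) - 1) * b ^ 3) :=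
        mul_le_mul_of_nonneg_left h1 (by positivity)
      have h3 : 4 * 2 * b ^ 3 ≤ 4 * Real.pi * b ^ 3 := by
        have := Real.two_le_pi
        gcongr
      nlinarith
    have hβL : 2 * (b / 4) < L := by linarith
    have hI : ((N : ℝ) - 1) * (16 * Real.pi * a * (b / 4) ^ 2) < L ^ 3 := by
      have h' : ((N : ℝ) - 1) * (16 * Real.pi * a * (b / 4) ^ 2) =
          4 * Real.pi * ((N : ℝ) - 1) * b ^ 3 * (a / b) / 4 := by
        field_simp
        ring
      rw [h', hb3]
      have hL3 : 0 < L ^ 3 := by positivity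
      nlinarith
    exact (periodicGroundStateEnergy_le_jastrow hB hv hab₀ hA' hN hL hb4 hβL hI).trans
      (ENNReal.ofReal_le_ofReal (jastrow_optimisation hN' ha0' hb0 hx hb3))

end Literature.MathematicalPhysics.QuantumManyBody.BoseGas

end
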